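import Summits.CriticalPhenomena.CardyFormulaZ2.Theorems.CardyBondTriangularBondTriangularCardyKiteColour
import HarnessLib

/-!
# Route CardyBondTriangular · crux `BondTriangularCardy` · line `birth`: the kite-interface toolkit, III — the interface inside a marked domain

Helper of the stub `stub_clDuality`. For the kite colouring `kc D σ` of a configuration `σ` of
the Chayes–Lei hexagon model on a 4-marked discrete domain `D` (file II): the darts of the closed
domain `⋃_{x ∈ G} H_x` (`Dart.touches`: a split half-line of an inside hexagon, or a spoke on an
edge of `H` with an inside hexagon on one side), the **good darts** (interface darts of the
domain, `good D σ`), and the three local facts of Bollobás–Riordan's interface-following argument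
(*Percolation* (2006), Ch. 7, Lemma 5 p. 170: "every vertex of the interface has degree `0` or
`2`, except `y₁, …, y₄`") in the kite tiling:

* `kc_midpoint₁`, `kc_midpoint₂`: at the midpoint of an edge of `H` in the domain the "diagonal"
  colour patterns do not occur (inside: a hexagon yellow at an up-corner is yellow at the
  neighbouring down-corner, Chayes–Lei 2007 §2.1; outside: the two outside kites at a boundary
  edge agree), so the kites of each colour are consecutive around every vertex;
* `isIface_succ_of_good`: the successor of a good dart is an interface dart;
* `touches_succ_of_good`: it is again a dart of the domain unless the dart runs into a corner with
  one inside hexagon whose two outside kites have different colours — by `corner_transition`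
  this only happens at a marked site, where the followed interface ends (file IV).

References: Bollobás–Riordan 2006 Ch. 7 Lemma 5 pp. 169–171; Chayes–Lei 2007 §2.1.
-/

namespace Summit.CriticalPhenomena.CardyFormulaZ2.Theorems.BondTriangularCardyLine.Kite

open Literature.Probability.Percolation Literature.Probability.LatticeModels

namespace Dart

/-- **The dart lies in the closed domain** `⋃_{x ∈ G} H_x`: a split half-line of an inside
hexagon, or a spoke on an edge of `H` bounding an inside hexagon. -/
def touches (G : Finset (Site 2)) : Dart → Bool
  | ⟨x, _, .splitIn⟩ => decide (x ∈ G)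
  | ⟨x, _, .splitOut⟩ => decide (x ∈ G)
  | ⟨x, k, .spokeIn⟩ => decide (x ∈ G ∨ x + triDir k ∈ G)
  | ⟨x, k, .spokeOut⟩ => decide (x ∈ G ∨ x + triDir k ∈ G)

end Dart

variable {D : TriMarkedDomain 4} {σ : CLHexConfig}

variable (D σ) in
/-- **The good darts**: interface darts of the kite colouring of `σ` lying in the closed domain. -/
def good : Set Dart := {d | d ∈ iface (kc D σ) ∧ d.touches D.verts = true}

/-! ### No diagonal pattern at a midpoint -/

/-- A parity fact on `Fin 6`. -/
theorem fin6_even_or_add_three_even (k : Fin 6) : k.val % 2 = 0 ∨ (k + 3).val % 2 = 0 := by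
  fin_cases k <;> decide

/-- Another parity fact on `Fin 6`. -/
theorem fin6_add_two_even_or_add_five_even (k : Fin 6) : (k + 2).val % 2 = 0 ∨ (k + 5).val % 2 = 0 := by
  fin_cases k <;> decide

/-- **No diagonal pattern, I**: at the midpoint of the edge `k` of `H_x` (in the domain) it is
impossible that `x` is yellow at the corner `k` and blue at `k + 5` while the neighbour
`y = x + triDir k` is yellow at `k + 5` (its corner `k + 3`) and blue at `k` (its `k + 2`). -/
theorem kc_midpoint₁ {x : Site 2} {k : Fin 6} (h : x ∈ D.verts ∨ x + triDir k ∈ D.verts)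
    (h1 : kc D σ x k = true) (h2 : kc D σ x (k + 5) = false) (h3 : kc D σ (x + triDir k) (k + 3) = true) :
    kc D σ (x + triDir k) (k + 2) = true := by
  by_contra h4
  rw [Bool.not_eq_true] at h4
  by_cases hx : x ∈ D.verts
  · by_cases hy : x + triDir k ∈ D.verts
    · rw [kc_of_mem σ hx] at h1 h2
      rw [kc_of_mem σ hy] at h3 h4
      rcases fin6_even_or_add_three_even k with he | he
      · rw [cornerY_add_five_of_even _ he h1] at h2; exact absurd h2 (by decide)
      · have := cornerY_add_five_of_even _ he h3
        rw [fin6_add_three_add_five, h4] at this; exact absurd this (by decide)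
    · have := kc_add_five (σ := σ) (k := k + 3) hy (by rwa [triDir_add_three, add_neg_cancel_right])
      rw [fin6_add_three_add_five, h3, h4] at this; exact absurd this (by decide)
  · have := kc_add_five (σ := σ) hx (h.resolve_left hx)
    rw [h1, h2] at this; exact absurd this (by decide)

/-- **No diagonal pattern, II** (the mirror image). -/
theorem kc_midpoint₂ {x : Site 2} {k : Fin 6} (h : x ∈ D.verts ∨ x + triDir k ∈ D.verts)
    (h1 : kc D σ x k = false) (h2 : kc D σ x (k + 5) = true) (h3 : kc D σ (x + triDir k) (k + 3) = false) :
    kc D σ (x + triDir k) (k + 2) = false := by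
  by_contra h4
  rw [Bool.not_eq_false] at h4
  by_cases hx : x ∈ D.verts
  · by_cases hy : x + triDir k ∈ D.verts
    · rw [kc_of_mem σ hx] at h1 h2
      rw [kc_of_mem σ hy] at h3 h4
      rcases fin6_add_two_even_or_add_five_even k with he | he
      · have := cornerY_add_one_of_even _ he h4
        rw [fin6_add_two_add_one, h3] at this; exact absurd this (by decide)
      · have := cornerY_add_one_of_even _ he h2
        rw [fin6_add_five_add_one, h1] at this; exact absurd this (by decide)
    · have := kc_add_five (σ := σ) (k := k + 3) hy (by rwa [triDir_add_three, add_neg_cancel_right])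
      rw [fin6_add_three_add_five, h3, h4] at this; exact absurd this (by decide)
  · have := kc_add_five (σ := σ) hx (h.resolve_left hx)
    rw [h1, h2] at this; exact absurd this (by decide)

/-- **Registered anchor of this file** (`kite_no_diagonal`): at the midpoint of an edge of `H` in
the domain, the diagonal pattern "`x` yellow at the corner `k`, blue at `k + 5`, the neighbour
yellow at `k + 5` and blue at `k`" does not occur (`kc_midpoint₁`). -/
theorem kite_no_diagonal : ∀ (D : Literature.Probability.Percolation.TriMarkedDomain 4) (σ : Literature.Probability.Percolation.CLHexConfig) (x : Literature.Probability.LatticeModels.Site 2) (k : Fin 6), (x ∈ D.verts ∨ x + Literature.Probability.Percolation.triDir k ∈ D.verts) → Summit.CriticalPhenomena.CardyFormulaZ2.Theorems.BondTriangularCardyLine.Kite.kc D σ x k = true → Summit.CriticalPhenomena.CardyFormulaZ2.Theorems.BondTriangularCardyLine.Kite.kc D σ x (k + 5) = false → Summit.CriticalPhenomena.CardyFormulaZ2.Theorems.BondTriangularCardyLine.Kite.kc D σ (x + Literature.Probability.Percolation.triDir k) (k + 3) = true → Summit.CriticalPhenomena.CardyFormulaZ2.Theorems.BondTriangularCardyLine.Kite.kc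 D σ (x + Literature.Probability.Percolation.triDir k) (k + 2) = true :=
  fun _ _ _ _ h h1 h2 h3 => kc_midpoint₁ h h1 h2 h3

/-! ### The successor of a good dart -/

/-- **The successor of a good dart is an interface dart** (at a centre: the centre rule of
admissible states). -/
theorem isIface_succ_of_good {d : Dart} (hd : d ∈ good D σ) : succ (kc D σ) d ∈ iface (kc D σ) := by
  obtain ⟨hi, ht⟩ := hd
  rcases d with ⟨x, k, κ⟩
  cases κ
  · exact isIface_succ_spokeIn hi
  · exact isIface_succ_spokeOut hi
  · exact isIface_succ_splitIn hi
  · refine isIface_succ_splitOut hi (centreOK_of_mem σ ?_)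
    simpa [Dart.touches] using ht

/-- **The successor stays in the domain, except at a transition corner**: if the successor of a
good dart is not a dart of the domain, the dart is a spoke into a corner with exactly one inside
hexagon whose two outside kites have different colours, the yellow one first (anticlockwise). -/
theorem touches_succ_of_good {d : Dart} (hd : d ∈ good D σ) (hn : (succ (kc D σ) d).touches D.verts = false) :
    d.kind = .spokeIn ∧ d.x + triDir (d.k + 1) ∉ D.verts ∧
      ((d.x ∈ D.verts ∧ d.x + triDir d.k ∉ D.verts ∧ kc D σ (d.x + triDir d.k) (d.k + 2) = true ∧
          kc D σ (d.x + triDir (d.k + 1)) (d.k + 4) = false) ∨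
        (d.x ∉ D.verts ∧ d.x + triDir d.k ∈ D.verts ∧ kc D σ (d.x + triDir (d.k + 1)) (d.k + 4) = true ∧
          kc D σ d.x d.k = false)) := by
  obtain ⟨⟨hR, hL⟩, ht⟩ := hd
  rcases d with ⟨x, k, κ⟩
  cases κ <;> simp only [Dart.R, Dart.L] at hR hL <;> simp only [Dart.touches, decide_eq_true_eq] at ht <;>
    simp only [succ] at hn
  · -- spokeIn
    split_ifs at hn with h1
    · simp only [Dart.touches, add_triDir_add_triDir_add_two, decide_eq_false_iff_not, not_or] at hn
      refine ⟨rfl, hn.2, Or.inl ⟨?_, hn.1, hR, h1⟩⟩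
      exact ht.resolve_right hn.1
    · simp only [Dart.touches, add_triDir_succ_add_triDir_add_four, decide_eq_false_iff_not, not_or] at hn
      refine ⟨rfl, hn.1, Or.inr ⟨hn.2, ht.resolve_left hn.2, by simpa using h1, hL⟩⟩
  · -- spokeOut
    exfalso
    split_ifs at hn with h1 h2
    · simp only [Dart.touches, decide_eq_false_iff_not] at hn
      have := kc_add_five (σ := σ) hn (ht.resolve_left hn)
      rw [hR, h1] at this; exact absurd this (by decide)
    · simp only [Dart.touches, triDir_add_three, add_neg_cancel_right, decide_eq_false_iff_not, not_or] at hn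
      exact hn.2 (ht.resolve_right hn.1)
    · simp only [Dart.touches, decide_eq_false_iff_not] at hn
      have := kc_add_five (σ := σ) (k := k + 3) hn (by rw [triDir_add_three, add_neg_cancel_right]; exact ht.resolve_right hn)
      rw [fin6_add_three_add_five, hL] at this
      rw [← this] at h2; exact h2 rfl
  · -- splitIn
    exfalso
    split_ifs at hn with h1 h2
    · simp only [Dart.touches, triDir_add_three, add_neg_cancel_right, decide_eq_false_iff_not, not_or] at hn
      exact hn.2 ht
    · simp only [Dart.touches, decide_eq_false_iff_not] at hn
      have := kc_add_five (σ := σ) (k := k + 3) hn (by rw [triDir_add_three, add_neg_cancel_right]; exact ht)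
      rw [fin6_add_three_add_five, h2] at this
      rw [← this] at h1; exact h1 rfl
    · simp only [Dart.touches, decide_eq_false_iff_not, not_or] at hn
      exact hn.1 ht
  · -- splitOut
    exfalso
    simp only [Dart.touches, decide_eq_false_iff_not] at hn
    exact hn ht

/-- The good darts form a finite set: they are darts at inside hexagons or across an edge from one. -/
theorem touches_iff_mem_image (G : Finset (Site 2)) (d : Dart) :
    d.touches G = true ↔ d ∈ ((G ×ˢ (Finset.univ : Finset (Fin 6))) ×ˢ
        ({Kind.spokeIn, Kind.spokeOut, Kind.splitIn, Kind.splitOut} : Finset Kind)).image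
          (fun p => (⟨p.1.1, p.1.2, p.2⟩ : Dart)) ∪
      ((G ×ˢ (Finset.univ : Finset (Fin 6))) ×ˢ ({Kind.spokeIn, Kind.spokeOut} : Finset Kind)).image
          (fun p => (⟨p.1.1 + triDir (p.1.2 + 3), p.1.2, p.2⟩ : Dart)) := by
  rcases d with ⟨x, k, κ⟩
  simp only [Finset.mem_union, Finset.mem_image, Finset.mem_product, Finset.mem_univ, and_true,
    Finset.mem_insert, Finset.mem_singleton, Prod.exists, Dart.mk.injEq]
  constructor
  · intro h
    cases κ <;> simp only [Dart.touches, decide_eq_true_eq] at h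
    · rcases h with h | h
      · exact Or.inl ⟨x, k, _, ⟨h, Or.inl rfl⟩, rfl, rfl, rfl⟩
      · exact Or.inr ⟨x + triDir k, k, _, ⟨h, Or.inl rfl⟩, by simp [triDir_add_three], rfl, rfl⟩
    · rcases h with h | h
      · exact Or.inl ⟨x, k, _, ⟨h, Or.inr (Or.inl rfl)⟩, rfl, rfl, rfl⟩
      · exact Or.inr ⟨x + triDir k, k, _, ⟨h, Or.inr rfl⟩, by simp [triDir_add_three], rfl, rfl⟩
    · exact Or.inl ⟨x, k, _, ⟨h, Or.inr (Or.inr (Or.inl rfl))⟩, rfl, rfl, rfl⟩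
    · exact Or.inl ⟨x, k, _, ⟨h, Or.inr (Or.inr (Or.inr rfl))⟩, rfl, rfl, rfl⟩
  · rintro (⟨x', k', κ', ⟨hx', -⟩, rfl, rfl, rfl⟩ | ⟨x', k', κ', ⟨hx', hκ⟩, rfl, rfl, rfl⟩)
    · cases κ' <;> simp [Dart.touches, hx']
    · have e : x' + triDir (k' + 3) + triDir k' = x' := by
        rw [show triDir k' = -triDir (k' + 3) by rw [← triDir_add_three, fin6_add_three_add_three], add_neg_cancel_right]
      rcases hκ with rfl | rfl <;> simp [Dart.touches, hx', e]

end Summit.CriticalPhenomena.CardyFormulaZ2.Theorems.BondTriangularCardyLine.Kite
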